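import Summits.ABC.IUTFork.Repair.RHR4DiscriminatorOneSided
import Literature.IUT.LogVolume.Corollary22With
import HarnessLib

/-!
# R-H ROUND 4, census row O-34 (card `vojta-dictionary-doors`): the κ₁ doors' PLACEMENT statement `DoorThm110At a μ₀ l` — print's typed [IUTchIV] Thm 1.10
# interface at the prime `l` with the display DILATED by `Λ(κ′, μ₀, l) = D_{j²}(l⋆)/(μ₀·D_{⌈j^{κ′}⌉}(l⋆))` — and LEMMA G in kernel form

abc-iut cell, rung LADDER-ABC:A2.RESCUE.H; seat abc-iut-rh4-typ-1 (GEN 0, R4-3 TYPER, KEY `wake/KEY-abc-iut-rh4-typ-1-R4IDEA-TYPE.md` 2342d1cdeb6caa1f); census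
`plan/rescue/R-H/ROUND4/OPENINGS-CENSUS.md` row O-34 (v0.11: «placement word SURVIVES as BOOKKEEPING … rh4-typ-1 may type R-v1 `DoorThm110At` with the amended
dictionary word»); card `ROUND4/IDEAS/card-vojta-dictionary-doors.md` 46d5dce04977c98c (rh4-id-4, lens 4 VOJTA; R-v1 `doorLambda` / `DoorThm110At`, scratch
`R4IdeaVojtaSketch.lean` 09cc61d8b2a714a0 with its `lawSum` replaced here by the tree's `demandSum f 1 n`, p506542); verdict `crit-vojta-dictionary-doors-rh4-crit-2.md`
4d95658220b42e30 (rh4-crit-2 §4: «= `Cor22.Thm110LegendreWith` with Λ := doorLambda k μ₀ l; claim-tagged HYPOTHESIS»); R4-1 memos engine A abc-iut-rh-kit-1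
17fd66b82ad063c5 §1.2 / engine B abc-iut-rh2-xi-1 fe85d7ed8a225a7a (A ≡ B: `Λ_{κ′,μ₀}(l) = S₂(l⋆)/(μ₀·S_f(l⋆))`); p-face `RHR4DiscriminatorOneSided` (abc-iut-rh2-xi-1;
the same quotient inline, `one_le_dilation_lawPow`, `dilation_values_seven`). Sibling of `RHRound4Objects.lean` (the R4-3 objects; this row is a PLACEMENT, not an object).
WHAT IS TYPED (namespace `Summit.ABC.IUTFork.Repair.RH.Round4DoorPlacement`; plain `def`, no instance, no notation): `doorLambda a μ₀ l` (the dilation factor over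
`demandSum (lawPow ·) 1 l⋆`); `DoorThm110At a μ₀ l` = the body of `Cor22.Thm110LegendreWith Λ` (`Literature.IUT.LogVolume.Corollary22With`) at ONE prime `l` with
`Λ := doorLambda a μ₀ l`, and `DoorThm110 a μ₀ := ∀ l, DoorThm110At a μ₀ l`; bookkeeping `one_le_doorLambda` (BY NAME), `doorLambda_seven` (BY NAME), LEMMA G
`doorThm110At_of_thm110Legendre` / `doorThm110_of_thm110Legendre` (print's interface ⟹ every door's, via `DisplayWith.of_display`), and the converse shape
`thm110LegendreWith_of_doorThm110` (a CONSTANT bound on `Λ` recovers the tree's interface — for κ′ = 1 no such bound exists: `(l+4)/(3μ₀)`, the card's «degree defect»).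
HONEST FRAMING / GUARDS: `DoorThm110At` is a HYPOTHESIS SHAPE in OUR typed currency (a door's implied actual-curve inequality), asserted at no point; `Thm110Legendre` is
claim-tagged and asserted nowhere; the lemmas are conditional bookkeeping; no Literature fact is added (inputs ⊆ the frozen FACT-LIST f75a60bac22efdb6 + landed modules);
typed ≠ proved; computed ≠ proved; located ≠ adjudicated; nothing here asserts that abc is proved or refuted, or takes a side on [IUTchIII] Cor. 3.12 / [IUTchIV] Thm. 1.10
or on any author (D-0045). [claim: Mochizuki2012, status: disputed] [cite: Mochizuki2012, IUTchIV Thm. 1.10 p. 21–29, Cor. 2.2 p. 45–46] [cite: Vojta1987, Conj. 5.7.5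
p. 61–62, 5.A.2 p. 64]
-/

noncomputable section

open Finset

namespace Summit.ABC.IUTFork.Repair.RH.Round4DoorPlacement

open Summit.ABC.IUTFork.Repair.RH.ReqsideWeightLaws

/-! ## The dilation factor and the placement statement -/

section Placement

open Literature.IUT.LogVolume Literature.IUT.LogVolume.Cor22 Literature.NumberTheory.DiophantineGeometry.GenEll
open Summit.ABC.IUTFork.Repair.RH.R4Discriminator

/-- **THE DOOR DILATION FACTOR `Λ(κ′ = a/2, μ₀, l) = D_{j²}(l⋆)/(μ₀·D_{⌈j^{a/2}⌉}(l⋆))`**, `l⋆ = (l−1)/2`, `D_f(n) = demandSum f 1 n` (p506542) — the factor by which a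
κ₁ door `(κ′, μ₀)` DILATES print's typed [IUTchIV] Thm 1.10 display (R4-1 memos engine A abc-iut-rh-kit-1 17fd66b82ad063c5 §1.2 / engine B abc-iut-rh2-xi-1
fe85d7ed8a225a7a, A ≡ B; card `vojta-dictionary-doors` 46d5dce04977c98c R-v1 `doorLambda`, with its scratch `lawSum` replaced by the tree's `demandSum`; p-face
`RHR4DiscriminatorOneSided` states the same quotient inline). κ′ = 1 closed form `(l+4)/(3μ₀)`; `l = 7` values `doorLambda_seven`. Bookkeeping, a real number.
[claim: Mochizuki2012, status: disputed] -/
@[claim "Mochizuki2012" "disputed"]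
def doorLambda (a : ℕ) (μ₀ : ℝ) (l : ℕ) : ℝ :=
  ((demandSum (lawPow 4) 1 ((l - 1) / 2) : ℤ) : ℝ) / (μ₀ * ((demandSum (lawPow a) 1 ((l - 1) / 2) : ℤ) : ℝ))

/-- **ONE-SIDEDNESS** (`RHR4DiscriminatorOneSided.one_le_dilation_lawPow` BY NAME): for the census laws `2 ≤ a ≤ 4`, `l ≥ 5` (so `l⋆ ≥ 2`) and `0 < μ₀ ≤ 1`,
`1 ≤ doorLambda a μ₀ l` — every door's display is WEAKER than print's. [folklore] -/
theorem one_le_doorLambda {a : ℕ} (ha2 : 2 ≤ a) (ha4 : a ≤ 4) {l : ℕ} (hl : 5 ≤ l) {μ₀ : ℝ} (hμ : 0 < μ₀) (hμ1 : μ₀ ≤ 1) :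
    1 ≤ doorLambda a μ₀ l :=
  one_le_dilation_lawPow ha2 ha4 (by omega) hμ hμ1

/-- The `l = 7` values (`l⋆ = 3`; `dilation_values_seven` BY NAME): `Λ(1, 27/64, 7) = 704/81`, `Λ(1, ½, 7) = 22/3`, `Λ(1, ¾, 7) = 44/9`, `Λ(3/2, 27/64, 7) = 704/189`,
`Λ(3/2, ½, 7) = 22/7` — doors O-01 … O-05 at their common corner `l = 7`. [folklore] -/
theorem doorLambda_seven :
    doorLambda 2 (27 / 64) 7 = 704 / 81 ∧ doorLambda 2 (1 / 2) 7 = 22 / 3 ∧ doorLambda 2 (3 / 4) 7 = 44 / 9 ∧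
      doorLambda 3 (27 / 64) 7 = 704 / 189 ∧ doorLambda 3 (1 / 2) 7 = 22 / 7 :=
  dilation_values_seven

/-- **`DoorThm110At a μ₀ l` — THE PLACEMENT STATEMENT of the κ₁ door `(κ′ = a/2, μ₀)` at the prime `l`** (card `vojta-dictionary-doors` 46d5dce04977c98c R-v1; verdict
rh4-crit-2 4d95658220b42e30 §4; census O-34): print's typed [IUTchIV] Thm 1.10 interface (`Cor22.Thm110Legendre`: for every `η_prm`, every `P ∈ UP` admitting a core with
(P2)/(P5)/(P6) at `l`) with the display DILATED by `Λ = doorLambda a μ₀ l` — i.e. the body of `Cor22.Thm110LegendreWith Λ` at this one `l`. DICTIONARY WORD (crit-2 §2,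
amended): in the Vojta / Szpiro / abc dictionary this is a member of SZPIRO'S ORIGINAL conjecture CLASS («6 replaced by an undetermined constant», Vojta 5.A.2 p.64) with the
exponent EXPLICIT, `E_eff = 6·Λ·(1 + 20·d_mod/l)` (`l`-dependent: κ′ = 1 `6(l+4)(l+20)/(3μ₀·l)`-shape, unbounded in `l`), and the additive constant explicit
(`120·Λ·(552960·d_mod·l + η)` nats) = Vojta 5.7.5 on `M̄_{1,1}` with `t = 6/E_eff` (p.61–62): IMPLIED by Szpiro `6 + ε` up to the additive constant (conjecture-tagged in the
tree); implies nothing known-false (record Szpiro ratio 9.02 < 64.57 = the smallest door exponent, `Literature/Barriers/ABC/SzpiroEpsilonCannotBeDropped`); shadow of NO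
known theorem (crit-2 F2 lookup null); under print's own `√h`-window the κ′ = 1 members are shadows of a TRIVIAL statement (`downstream_vacuous_of_window`, p536146). A
HYPOTHESIS SHAPE; nothing asserts it at any point. [claim: Mochizuki2012, status: disputed] -/
@[claim "Mochizuki2012" "disputed"]
def DoorThm110At (a : ℕ) (μ₀ : ℝ) (l : ℕ) : Prop :=
  ∀ η : ℝ, IsEtaPrm η → ∀ P : NFPoint, P ∈ UP → l.Prime → 5 ≤ l →
    AdmitsCore P → CondP2 P l → CondP5 P l → CondP6 P l → DisplayWith P l η (doorLambda a μ₀ l)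

/-- The placement statement along ALL primes (card R-v1 `DoorThm110`; `l`-indexed form of `Cor22.Thm110LegendreWith`). [claim: Mochizuki2012, status: disputed] -/
@[claim "Mochizuki2012" "disputed"]
def DoorThm110 (a : ℕ) (μ₀ : ℝ) : Prop :=
  ∀ l : ℕ, DoorThm110At a μ₀ l

/-- **LEMMA G in kernel form** (engine A §1.4 / engine B §2.5; `Cor22.DisplayWith.of_display`): print's typed Thm 1.10 interface IMPLIES every census door's placement
statement at every prime `l ≥ 5` (`2 ≤ a ≤ 4`, `0 < μ₀ ≤ 1`) — the discriminator is ONE-SIDED: only data violating print's display by the factor `Λ` can violate a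
door's. Conditional bookkeeping; `Thm110Legendre` is a claim-tagged hypothesis, asserted nowhere. [folklore] -/
theorem doorThm110At_of_thm110Legendre {a : ℕ} (ha2 : 2 ≤ a) (ha4 : a ≤ 4) {μ₀ : ℝ} (hμ : 0 < μ₀) (hμ1 : μ₀ ≤ 1) (l : ℕ)
    (h : Thm110Legendre) : DoorThm110At a μ₀ l :=
  fun η hη P hP hl h5 hc h2 h5' h6 =>
    DisplayWith.of_display hη.1.le (one_le_doorLambda ha2 ha4 h5 hμ hμ1) (h η hη P hP l hl h5 hc h2 h5' h6)

/-- Hence along all primes: `Thm110Legendre → DoorThm110 a μ₀` for the census laws and targets. [folklore] -/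
theorem doorThm110_of_thm110Legendre {a : ℕ} (ha2 : 2 ≤ a) (ha4 : a ≤ 4) {μ₀ : ℝ} (hμ : 0 < μ₀) (hμ1 : μ₀ ≤ 1) (h : Thm110Legendre) :
    DoorThm110 a μ₀ := fun l => doorThm110At_of_thm110Legendre ha2 ha4 hμ hμ1 l h

/-- Conversely a CONSTANT dilation bound recovers the tree's interface: if `doorLambda a μ₀ l ≤ Λ` at every prime `l ≥ 5` then `DoorThm110 a μ₀ → Thm110LegendreWith Λ`
(`DisplayWith.mono`). For κ′ = 1 no such `Λ` exists (`doorLambda 2 μ₀ l = (l+4)/(3μ₀)` is unbounded — the card's «degree defect», `uConst_id` p508156); recorded as the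
exact shape of that obstruction. [folklore] -/
theorem thm110LegendreWith_of_doorThm110 {a : ℕ} {μ₀ Λ : ℝ} (hΛ : ∀ l : ℕ, l.Prime → 5 ≤ l → doorLambda a μ₀ l ≤ Λ) (h : DoorThm110 a μ₀) :
    Thm110LegendreWith Λ :=
  fun η hη P hP l hl h5 hc h2 h5' h6 => (h l η hη P hP hl h5 hc h2 h5' h6).mono hη.1.le (hΛ l hl h5)

end Placement

end Summit.ABC.IUTFork.Repair.RH.Round4DoorPlacement

end
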